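import Mathlib
import Summits.ResolutionOfSingularities.ResolutionOfSingularities.Theorems.WeightedInvariantLocalWeightedDropNCGameRankMoves
import Summits.ResolutionOfSingularities.ResolutionOfSingularities.Theorems.WeightedInvariantLocalWeightedDropNCGameDecoratedWins
import Summits.ResolutionOfSingularities.ResolutionOfSingularities.Theorems.WeightedInvariantLocalWeightedDropSpaceNCCountOfCJSB

/-!
# `WeightedInvariant.LocalWeightedDrop` — ordinal wins of the NC count game, part 2: REGION TRANSPORT BY SIMULATION, the move
# constructor with UNBOUNDED successor values, and `WinsOrd` as decorated winning with the trivial decoration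

Crux item stmt-ResolutionOfSingularities-8899 `LocalWeightedDrop` (route `ResolutionOfSingularities/WeightedInvariant`), ENGINE skeleton
v32; companion of `…NCGameRankMoves` (res-D-pv-006, p538182: the value-bounded move constructor `winsOrd_move` and the unit /
coordinate-change invariances of `WinsOrd`, for the ordinal endgame of res-L1-w43-strat-1's line `directrix-cut`).  [OURS · L1 W4.3 · chain
w43 · res-L1-w43-stub-4 gen 5.  Game bookkeeping over `k⟦x⟧` for the programme's own count game (res-type-056); nothing here is a
statement of any manuscript; AI-produced, gate-checked, weaker than expert review.]

What this file adds to `…NCGameRank` / `…NCGameRankMoves` / `…NCGameDecoratedWins` (every field, every dimension, any terminal predicate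
`P` where the statement allows):
* `dWinsTo_id_of_winsOrd`, `exists_winsOrd_of_dWinsTo_id`, `exists_winsOrd_iff_dWinsTo_id` — transfinite winnability of a germ IS
  decorated winning with the trivial decoration (`St := k⟦x⟧`, `germ := id`), so the calculus of `…NCGameDecoratedWins` (`DWinsTo.bind`,
  `DWinsTo.of_measure`, `DWinsTo.wf_induction`) applies to bare germs;
* **`exists_winsOrd_move`** — the move constructor with UNBOUNDED successor values: a legal move all of whose successors are
  transfinitely winnable (no common bound on their values is asked — over an infinite field a move has infinitely many answers) makes
  the position transfinitely winnable (`winsOrd_move` of `…NCGameRankMoves` is the value-bounded form «all successors `< α` ⇒ value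
  `≤ α`»);
* **`winsOrd_of_simulation`** — REGION TRANSPORT (value preserved): a relation `R b d` along which terminality descends and every
  legal move from `d` is simulated by a legal move from `b` with `R`-related successors transports `WinsOrd P α` from `d` to `b`; the
  proof pattern of `winsOrd_of_dvd_pow` (p525270) made generic — unit multiples, legal substitutions (both landed directly in
  `…NCGameRankMoves`) and radical divisors are ten-line instances, and so is any future transport of the same shape;
* `winsOrd_germIsNC_of_dvd_pow` — radical transport for `GermIsNC` by name (heredity `germIsNC_of_dvd_pow`), and the `∃ α` forms
  `exists_winsOrd_germIsNC_unit_mul / _of_subst / _subst / _of_dvd_pow`, `exists_winsOrd_of_winsIn`, `exists_winsOrd_of_terminal`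
  used by ports of finite-round (`WinsIn`) strategies to ordinal oracles.
-/

set_option linter.dupNamespace false -- mandated namespace of this single-conjunct summit

noncomputable section

namespace Summit.ResolutionOfSingularities.ResolutionOfSingularities.Theorems

namespace TameFourTupleDrop

open MvPowerSeries Literature.AlgebraicGeometry.Resolution

variable {k : Type} [Field k] {m : ℕ}

/-! ## Transfinite winnability as decorated winning with the trivial decoration -/

/-- A ranked winning region is a decorated ranked region for the identity decoration. -/
theorem dWinsTo_id_of_winsOrd {P : MvPowerSeries (Fin (m + 1)) k → Prop} {α : Ordinal.{0}} {b : MvPowerSeries (Fin (m + 1)) k}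
    (h : WinsOrd P α b) : DWinsTo (St := MvPowerSeries (Fin (m + 1)) k) id P b := by
  obtain ⟨T, ρ, hT, hb, -⟩ := h
  refine ⟨T, ρ, fun d hd hPd => ?_, hb⟩
  obtain ⟨Φ, w, hmv, hcl⟩ := hT d hd hPd
  exact ⟨Φ, w, hmv, hcl.mono fun d' ⟨hd', hlt⟩ => ⟨d', hd', rfl, hlt⟩⟩

/-- Conversely (`winsOrd_of_dWinsTo` with the identity decoration). -/
theorem exists_winsOrd_of_dWinsTo_id {P : MvPowerSeries (Fin (m + 1)) k → Prop} {b : MvPowerSeries (Fin (m + 1)) k}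
    (h : DWinsTo (St := MvPowerSeries (Fin (m + 1)) k) id P b) : ∃ α, WinsOrd P α b :=
  winsOrd_of_dWinsTo (germ := id) (P := P) h

/-- `∃ α, WinsOrd P α b ↔ DWinsTo id P b`. -/
theorem exists_winsOrd_iff_dWinsTo_id {P : MvPowerSeries (Fin (m + 1)) k → Prop} {b : MvPowerSeries (Fin (m + 1)) k} :
    (∃ α, WinsOrd P α b) ↔ DWinsTo (St := MvPowerSeries (Fin (m + 1)) k) id P b :=
  ⟨fun ⟨_, h⟩ => dWinsTo_id_of_winsOrd h, exists_winsOrd_of_dWinsTo_id⟩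

/-! ## The move constructor with unbounded successor values -/

/-- **THE MOVE CONSTRUCTOR WITH UNBOUNDED SUCCESSOR VALUES.**  If some legal move from `b` has, at every answer, a live slot whose new
position is transfinitely winnable — with no common bound on the values — then `b` is transfinitely winnable.  (One move reaches the target
«transfinitely winnable» (`DWinsTo.of_measure` on the one-point class), then the successors' regions are played (`DWinsTo.bind`); the value
of `b` is implicitly the supremum of the successors' values plus one.) -/
theorem exists_winsOrd_move {P : MvPowerSeries (Fin (m + 1)) k → Prop} {b : MvPowerSeries (Fin (m + 1)) k}
    {Φ : Fin (m + 1) → MvPowerSeries (Fin (m + 1)) k} {w : Fin (m + 1) → ℕ} (hmv : IsCountMove Φ w)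
    (h : MoveClause b Φ w (fun b' => ∃ α, WinsOrd P α b')) : ∃ α, WinsOrd P α b := by
  classical
  have h1 : DWinsTo (St := MvPowerSeries (Fin (m + 1)) k) id (fun d => ∃ α, WinsOrd P α d) b := by
    refine DWinsTo.of_measure (germ := id) ({b} : Set (MvPowerSeries (Fin (m + 1)) k)) (fun _ => (0 : Ordinal.{0}))
      (fun τ hτ _ => ?_) (Set.mem_singleton b)
    rw [Set.mem_singleton_iff] at hτ
    subst hτ
    exact ⟨Φ, w, hmv, h.mono fun b' hb' => ⟨b', rfl, Or.inl hb'⟩⟩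
  exact exists_winsOrd_of_dWinsTo_id (h1.bind fun d hd => exists_winsOrd_iff_dWinsTo_id.mp hd)

/-! ## Region transport by simulation -/

/-- **REGION TRANSPORT BY SIMULATION** (value preserved).  Let `R b d` be a relation between positions along which terminality DESCENDS
(`R b d → P d → P b`) and moves LIFT: whenever `R b d`, `b` is not terminal, and `(Φ, w)` is a legal move from `d` satisfying the move clause
for some goodness predicate, there is a legal move from `b` whose clause is satisfied for «`R`-related to a good successor of `d`».  Then
`WinsOrd P α d → R b d → WinsOrd P α b`: the region of all `R`-relatives of members of `d`'s region, ranked by the least rank of a witness,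
playing the lifted move of a least witness. -/
theorem winsOrd_of_simulation {P : MvPowerSeries (Fin (m + 1)) k → Prop}
    (R : MvPowerSeries (Fin (m + 1)) k → MvPowerSeries (Fin (m + 1)) k → Prop)
    (hR0 : ∀ b d, R b d → P d → P b)
    (hR1 : ∀ b d, R b d → ¬ P b →
      ∀ (Φ : Fin (m + 1) → MvPowerSeries (Fin (m + 1)) k) (w : Fin (m + 1) → ℕ)
        (good : MvPowerSeries (Fin (m + 1)) k → Prop), IsCountMove Φ w → MoveClause d Φ w good →
        ∃ (Φ' : Fin (m + 1) → MvPowerSeries (Fin (m + 1)) k) (w' : Fin (m + 1) → ℕ),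
          IsCountMove Φ' w' ∧ MoveClause b Φ' w' (fun b' => ∃ d', R b' d' ∧ good d'))
    {α : Ordinal.{0}} {b d : MvPowerSeries (Fin (m + 1)) k} (hwin : WinsOrd P α d) (hbd : R b d) : WinsOrd P α b := by
  classical
  obtain ⟨T, ρ, hT, hdT, hρd⟩ := hwin
  let Wit : MvPowerSeries (Fin (m + 1)) k → Set (MvPowerSeries (Fin (m + 1)) k) := fun b' => {d' | d' ∈ T ∧ R b' d'}
  let T' : Set (MvPowerSeries (Fin (m + 1)) k) := {b' | (Wit b').Nonempty}
  let ρ' : MvPowerSeries (Fin (m + 1)) k → Ordinal.{0} := fun b' => sInf (ρ '' Wit b')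
  refine ⟨T', ρ', ?_, ⟨d, hdT, hbd⟩, ?_⟩
  · intro b' hb' hPb'
    have hne : (ρ '' Wit b').Nonempty := hb'.image ρ
    obtain ⟨d', ⟨hd'T, hRd'⟩, hd'ρ⟩ := (Set.mem_image _ _ _).mp (csInf_mem hne)
    have hPd' : ¬ P d' := fun hP => hPb' (hR0 _ _ hRd' hP)
    obtain ⟨Φ, w, hmv, hcl⟩ := hT d' hd'T hPd'
    obtain ⟨Φ', w', hmv', hcl'⟩ := hR1 _ _ hRd' hPb' Φ w _ hmv hcl
    refine ⟨Φ', w', hmv', hcl'.mono fun b'' ⟨d'', hRd'', hd''T, hlt⟩ => ?_⟩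
    have hwit : d'' ∈ Wit b'' := ⟨hd''T, hRd''⟩
    refine ⟨⟨d'', hwit⟩, ?_⟩
    calc ρ' b'' ≤ ρ d'' := csInf_le' (Set.mem_image_of_mem ρ hwit)
      _ < ρ d' := hlt
      _ = ρ' b' := hd'ρ
  · calc ρ' b ≤ ρ d := csInf_le' (Set.mem_image_of_mem ρ (show d ∈ Wit b from ⟨hdT, hbd⟩))
      _ ≤ α := hρd

/-! ## Radical transport for `GermIsNC` and the `∃ α` forms -/

/-- RADICAL TRANSPORT for `GermIsNC` (radical heredity is `germIsNC_of_dvd_pow`): `WinsOrd GermIsNC α d`, `d ≠ 0`, `b ∣ d^(N+1)` ⇒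
`WinsOrd GermIsNC α b`. -/
theorem winsOrd_germIsNC_of_dvd_pow {α : Ordinal.{0}} {N : ℕ} {b d : MvPowerSeries (Fin (m + 1)) k} (hd : d ≠ 0)
    (hwin : WinsOrd GermIsNC α d) (hbd : b ∣ d ^ (N + 1)) : WinsOrd GermIsNC α b :=
  winsOrd_of_dvd_pow (fun N b d hd hPd hbd => germIsNC_of_dvd_pow N b d hd hPd hbd) hd hwin hbd

/-- `∃`-form of `winsOrd_germIsNC_unit_mul`. -/
theorem exists_winsOrd_germIsNC_unit_mul {b : MvPowerSeries (Fin (m + 1)) k} (u : MvPowerSeries (Fin (m + 1)) k)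
    (hu : constantCoeff u ≠ 0) (h : ∃ α, WinsOrd GermIsNC α b) : ∃ α, WinsOrd GermIsNC α (u * b) := by
  obtain ⟨α, h⟩ := h
  exact ⟨α, winsOrd_germIsNC_unit_mul u hu h⟩

/-- `∃`-form of `winsOrd_germIsNC_of_subst`. -/
theorem exists_winsOrd_germIsNC_of_subst {Ψ : Fin (m + 1) → MvPowerSeries (Fin (m + 1)) k} (hΨ0 : ∀ i, constantCoeff (Ψ i) = 0)
    (hΨdet : IsUnit (Matrix.det (Matrix.of fun i j => coeff (Finsupp.single j 1) (Ψ i))))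
    {b : MvPowerSeries (Fin (m + 1)) k} (h : ∃ α, WinsOrd GermIsNC α (subst Ψ b)) : ∃ α, WinsOrd GermIsNC α b := by
  obtain ⟨α, h⟩ := h
  exact ⟨α, winsOrd_germIsNC_of_subst hΨ0 hΨdet h⟩

/-- `∃`-form of `winsOrd_germIsNC_subst`. -/
theorem exists_winsOrd_germIsNC_subst {Ψ : Fin (m + 1) → MvPowerSeries (Fin (m + 1)) k} (hΨ0 : ∀ i, constantCoeff (Ψ i) = 0)
    (hΨdet : IsUnit (Matrix.det (Matrix.of fun i j => coeff (Finsupp.single j 1) (Ψ i))))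
    {b : MvPowerSeries (Fin (m + 1)) k} (h : ∃ α, WinsOrd GermIsNC α b) : ∃ α, WinsOrd GermIsNC α (subst Ψ b) := by
  obtain ⟨α, h⟩ := h
  exact ⟨α, winsOrd_germIsNC_subst hΨ0 hΨdet h⟩

/-- `∃`-form of `winsOrd_germIsNC_of_dvd_pow`. -/
theorem exists_winsOrd_germIsNC_of_dvd_pow {N : ℕ} {b d : MvPowerSeries (Fin (m + 1)) k} (hd : d ≠ 0)
    (hwin : ∃ α, WinsOrd GermIsNC α d) (hbd : b ∣ d ^ (N + 1)) : ∃ α, WinsOrd GermIsNC α b := by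
  obtain ⟨α, h⟩ := hwin
  exact ⟨α, winsOrd_germIsNC_of_dvd_pow hd h hbd⟩

/-- `∃`-form of `winsOrd_of_winsIn` (finite wins are transfinite wins). -/
theorem exists_winsOrd_of_winsIn {P : MvPowerSeries (Fin (m + 1)) k → Prop} {n : ℕ} {b : MvPowerSeries (Fin (m + 1)) k}
    (h : WinsIn P n b) : ∃ α, WinsOrd P α b :=
  ⟨n, winsOrd_of_winsIn h⟩

/-- `∃`-form of `winsOrd_of_terminal`. -/
theorem exists_winsOrd_of_terminal {P : MvPowerSeries (Fin (m + 1)) k → Prop} {b : MvPowerSeries (Fin (m + 1)) k} (hb : P b) :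
    ∃ α, WinsOrd P α b :=
  ⟨0, winsOrd_of_terminal hb 0⟩

end TameFourTupleDrop

end Summit.ResolutionOfSingularities.ResolutionOfSingularities.Theorems

end
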